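import Summits.CriticalPhenomena.Ising3DConformalLimit.Theses.MarkovRigidity
import HarnessLib

/-!
# Birth skeleton — crux `MarkovInheritance` (item stmt-CriticalPhenomena-11236), route `MarkovRigidity`

BC3 skeleton (registrar `planner-skel-stmt-CriticalPhenomena-11236-0`, 2026-08-17), published as
`Cruxes/MarkovInheritance/Lines/birth.lean`.

## The seam: Rozanov's collar form (R) at positive thickness, then (R) ⇒ (K) by Lévy's downward theorem

The crux asks for McKean's GERM-Markov property (Kotani Def. 1 / Rozanov Ch. 2 (1.28), form (K)) of
the Ising scaling-limit law `μ` for open balls and open half-spaces `U`: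
`μ[F | 𝒜₊(Uᶜ) ⊔ 𝒜₊(∂U)] = μ[F | 𝒜₊(∂U)]` a.e. for bounded `F` measurable for the inner germ
`𝒜₊(U) = ⨅_{ε>0} 𝒜(U_ε)`, where `𝒜(A) = σ(ω f : tsupport f ⊆ A)` (the crux's inlined `sig`).

What the lattice hands over EXACTLY, at every mesh `δ < ε`, is not the germ form but Rozanov's
COLLAR form (R) (Rozanov 1982, Ch. 2 §1.3 (1.26)–(1.27)): for every thickness `ε > 0` the open collar
`(∂U)_ε` splits the field in `U` from the field in `(Uᶜ)_ε`. On `δℤ³` this is the identity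
`E[F(σ_U) | σ_x, dist(x,Uᶜ) < ε] = ⟨F⟩^{ξ}_{R}`, `R = {x ∈ U ∩ δℤ³ : dist(x,Uᶜ) ≥ ε}`, whose
boundary spins `ξ` on `∂R` and the spins of `U ∩ (∂U)_ε` all lie in the collar `(∂U)_ε`:
the DLR equation when `R` is finite (balls) and the GLOBAL Markov property of the plus state
(Goldstein 1980; Föllmer) when `R` is a half-space minus a slab (half-spaces). So the line is:

* `stub_collarMarkovBall` — (R) for the limit law and open balls, every `ε > 0`:
  `μ[F | 𝒜((Uᶜ)_ε)] = μ[F | 𝒜((∂U)_ε)]` a.e. (inheritance at POSITIVE thickness: both conditioning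
  σ-algebras are generated by fields smeared over OPEN sets of macroscopic width; no germs on the
  conditioning side; lattice input = DLR in the finite region `R`).
* `stub_collarMarkovHalfSpace` — the same for open half-spaces (lattice input = global Markov
  property of the critical plus state, an unbounded region `R`).
* `stub_germOfCollar` — (R) for all `ε > 0` ⇒ the crux's germ identity (K), for ANY probability law on
  `𝒮'(ℝ³)`, any set `U`, any bounded `F`: along `ε_n ↓ 0` both sides are reverse martingales, Lévy's
  DOWNWARD theorem (not in Mathlib: only the upward `Integrable.tendsto_ae_condExp` exists) gives
  `μ[F | 𝒜₊(Uᶜ)] = μ[F | 𝒜₊(∂U)]` a.e., and `𝒜₊(∂U) ≤ 𝒜₊(Uᶜ)` (as `∂U ⊆ closure Uᶜ` and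
  `thickening ε (closure A) = thickening ε A`) makes the `⊔` on the left redundant. This is Rozanov's
  (1.27) ⇒ (1.28) in conditional-expectation form; no exchange of `⨅` and `⊔` of σ-algebras is needed
  (the sandwich `𝒜₊(∂U) ≤ 𝒜₊(Uᶜ) ⊔ 𝒜₊(∂U) = 𝒜₊(Uᶜ) = ⨅_n 𝒜((Uᶜ)_{ε_n})` and the tower property do it).

`MarkovInheritance_of` composes them by pure logic (case split on the shape of `U`), concluding the
route decl `Summit.CriticalPhenomena.Ising3DConformalLimit.Theses.MarkovRigidity.MarkovInheritance`
BY NAME; `MarkovInheritance_proof` is the crux modulo exactly the three stubs.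

Where the difficulty sits (honestly): the two collar stubs carry the XL content of the crux —
whether the exact lattice identity survives the scaling limit at FIXED `ε` (the conditional
expectation given `𝒜((Uᶜ)_ε)` of the limit must be `𝒜((∂U)_ε)`-measurable: convergence of the
boundary-condition kernels `⟨·⟩^{ξ}_R` along the field limit, cf. the route's "why it might fail");
`stub_germOfCollar` isolates the `ε → 0` passage, which is a THEOREM (reverse martingale convergence),
so the germ subtlety ("conditional independence is not weakly closed", exchange of limits and
σ-algebras) is no longer entangled with the lattice limit.

Disproof used: none — no `Disproof.lean` is filed for stmt-CriticalPhenomena-11236 (crux dir empty at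
registration). Refuter evidence honoured: `boundaryGerm_le_outerGerm` / `lhs_sigma_eq_outer`
(FinalChecks.lean, Evidence.lean of the crux attacks) is exactly the redundancy of `⊔` used in
`stub_germOfCollar`; `germMarkov_conclusion_of_empty` (DegenerateBall.lean): for `U = ∅` all three
stubs hold trivially (`F` is then measurable for the trivial σ-algebra).

Sources: Rozanov1982 (Ch. 2 §1.3 (1.26)–(1.29)), McKean1963, Kotani1973 (Def. 1), Goldstein1980
(global Markov property of φ±), Israel1986, AlbeverioHeghkrohnZegarlinski1989, Nelson1973Construction;
Lévy's downward theorem: Williams, Probability with Martingales, §14.4.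
-/

noncomputable section

open MeasureTheory
open scoped MeasureTheory ProbabilityTheory BigOperators

namespace Summit.CriticalPhenomena.Ising3DConformalLimit.Cruxes.MarkovInheritance.Birth

local notation "E³" => EuclideanSpace ℝ (Fin 3)
local notation "Cfg" => Literature.MathematicalPhysics.QuantumLattice.FieldConfig (EuclideanSpace ℝ (Fin 3))

/-! ## §1 Statements of the stubs (`Sig.stub_*`) -/

/-- **(R) for balls, inherited.** Under the hypotheses of the crux (`S` the pointwise scaling limit
of `criticalCorr 3`, normalised off `NonCoincident`, non-degenerate, translation invariant, scale
covariant; `μ` a probability law on `𝒮'(ℝ³)` with all moments, exponential moments and moment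
densities `S`), for every open ball `U`, every bounded `F` measurable for the inner germ
`⨅_{ε>0} 𝒜(U_ε)` and EVERY thickness `ε > 0`:
`μ[F | 𝒜((Uᶜ)_ε)] = μ[F | 𝒜((∂U)_ε)]` μ-a.e. — Rozanov's collar Markov property (1.27) of the limit
law at positive thickness. Lattice input: DLR for the finite region `{x ∈ U : dist(x,Uᶜ) ≥ ε}`.
[Rozanov1982 Ch. 2 (1.27); Goldstein1980; AlbeverioHeghkrohnZegarlinski1989] -/
def Sig.stub_collarMarkovBall : Prop :=
  ∀ (ρ : ℝ → ℝ) (Δ : ℝ) (S : Literature.Probability.LatticeModels.CorrFamily 3) (μ : MeasureTheory.Measure Cfg),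
    (∀ δ ∈ Set.Ioc (0:ℝ) 1, 0 < ρ δ) →
    Literature.Probability.LatticeModels.HasPointwiseScalingLimit (Literature.Probability.LatticeModels.criticalCorr 3) ρ S →
    (∀ n z, z ∉ Literature.Probability.LatticeModels.NonCoincident 3 n → S n z = 0) →
    Literature.Probability.LatticeModels.IsNondegenerateTwoPoint S →
    Literature.Probability.LatticeModels.IsTranslationInvariant S →
    Literature.Probability.LatticeModels.IsScaleCovariant Δ S →
    MeasureTheory.IsProbabilityMeasure μ →
    Literature.MathematicalPhysics.QuantumLattice.HasAllMoments μ →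
    (∀ f : SchwartzMap E³ ℝ, MeasureTheory.Integrable (fun ω : Cfg => Real.exp (ω f)) μ) →
    (∀ (n : ℕ) (f : Fin n → SchwartzMap E³ ℝ), Literature.MathematicalPhysics.QuantumLattice.moment μ n f = ∫ x : Fin n → E³, S n x * ∏ i, f i (x i)) →
    ∀ (sig : Set E³ → MeasurableSpace Cfg),
      (sig = fun A => ⨆ (f : SchwartzMap E³ ℝ) (_ : tsupport ⇑f ⊆ A), MeasurableSpace.comap (fun ω : Cfg => ω f) (borel ℝ)) →
    ∀ (U : Set E³), (∃ (c : E³) (r : ℝ), U = Metric.ball c r) →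
    ∀ (F : Cfg → ℝ), @Measurable _ _ (⨅ (ε : ℝ) (_ : 0 < ε), sig (Metric.thickening ε U)) _ F →
      (∃ C : ℝ, ∀ ω, |F ω| ≤ C) →
    ∀ (ε : ℝ), 0 < ε →
      MeasureTheory.condExp (sig (Metric.thickening ε Uᶜ)) μ F =ᵐ[μ] MeasureTheory.condExp (sig (Metric.thickening ε (frontier U))) μ F

/-- **(R) for half-spaces, inherited.** The same collar Markov property at every thickness `ε > 0`
for open half-spaces `U = {x | a < ⟪x, v⟫}`, `v ≠ 0`. Lattice input: the GLOBAL Markov property of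
the critical plus state (the region `{x ∈ U : dist(x,Uᶜ) ≥ ε}` is unbounded), Goldstein 1980 /
Föllmer, which the DLR equations alone do not give (Israel1986: it fails for some Gibbs states).
[Rozanov1982 Ch. 2 (1.27); Goldstein1980; Israel1986; Nelson1973Construction] -/
def Sig.stub_collarMarkovHalfSpace : Prop :=
  ∀ (ρ : ℝ → ℝ) (Δ : ℝ) (S : Literature.Probability.LatticeModels.CorrFamily 3) (μ : MeasureTheory.Measure Cfg),
    (∀ δ ∈ Set.Ioc (0:ℝ) 1, 0 < ρ δ) →
    Literature.Probability.LatticeModels.HasPointwiseScalingLimit (Literature.Probability.LatticeModels.criticalCorr 3) ρ S →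
    (∀ n z, z ∉ Literature.Probability.LatticeModels.NonCoincident 3 n → S n z = 0) →
    Literature.Probability.LatticeModels.IsNondegenerateTwoPoint S →
    Literature.Probability.LatticeModels.IsTranslationInvariant S →
    Literature.Probability.LatticeModels.IsScaleCovariant Δ S →
    MeasureTheory.IsProbabilityMeasure μ →
    Literature.MathematicalPhysics.QuantumLattice.HasAllMoments μ →
    (∀ f : SchwartzMap E³ ℝ, MeasureTheory.Integrable (fun ω : Cfg => Real.exp (ω f)) μ) →
    (∀ (n : ℕ) (f : Fin n → SchwartzMap E³ ℝ), Literature.MathematicalPhysics.QuantumLattice.moment μ n f = ∫ x : Fin n → E³, S n x * ∏ i, f i (x i)) →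
    ∀ (sig : Set E³ → MeasurableSpace Cfg),
      (sig = fun A => ⨆ (f : SchwartzMap E³ ℝ) (_ : tsupport ⇑f ⊆ A), MeasurableSpace.comap (fun ω : Cfg => ω f) (borel ℝ)) →
    ∀ (U : Set E³), (∃ (v : E³) (a : ℝ), v ≠ 0 ∧ U = {x | a < inner ℝ x v}) →
    ∀ (F : Cfg → ℝ), @Measurable _ _ (⨅ (ε : ℝ) (_ : 0 < ε), sig (Metric.thickening ε U)) _ F →
      (∃ C : ℝ, ∀ ω, |F ω| ≤ C) →
    ∀ (ε : ℝ), 0 < ε →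
      MeasureTheory.condExp (sig (Metric.thickening ε Uᶜ)) μ F =ᵐ[μ] MeasureTheory.condExp (sig (Metric.thickening ε (frontier U))) μ F

/-- **(R) ⇒ (K): germs from collars (Rozanov (1.27) ⇒ (1.28), via Lévy's downward theorem).** For ANY
probability law `μ` on `𝒮'(ℝ³)`, any set `U` and any bounded `F`: if for every `ε > 0` the collar
identity `μ[F | 𝒜((Uᶜ)_ε)] = μ[F | 𝒜((∂U)_ε)]` holds a.e., then the crux's germ identity
`μ[F | 𝒜₊(Uᶜ) ⊔ 𝒜₊(∂U)] = μ[F | 𝒜₊(∂U)]` holds a.e. Proof on paper: along `ε_n = 1/(n+1)` both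
sides are reverse martingales converging a.e. to the conditional expectations given
`⨅_n 𝒜((Uᶜ)_{ε_n}) = 𝒜₊(Uᶜ)` and `𝒜₊(∂U)` (Lévy downward; `sig` is monotone in the set), and
`𝒜₊(∂U) ≤ 𝒜₊(Uᶜ)` since `thickening ε (frontier U) ⊆ thickening ε (closure Uᶜ) = thickening ε Uᶜ`.
(If `F` is not integrable every `condExp` is the junk `0` and the statement is trivially consistent.)
Size: M–L in Lean (the downward martingale convergence theorem is not in Mathlib).
[Rozanov1982 Ch. 2 §1.3 (1.26)–(1.28); McKean1963; Williams, Probability with Martingales §14.4] -/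
def Sig.stub_germOfCollar : Prop :=
  ∀ (μ : MeasureTheory.Measure Cfg), MeasureTheory.IsProbabilityMeasure μ →
    ∀ (sig : Set E³ → MeasurableSpace Cfg),
      (sig = fun A => ⨆ (f : SchwartzMap E³ ℝ) (_ : tsupport ⇑f ⊆ A), MeasurableSpace.comap (fun ω : Cfg => ω f) (borel ℝ)) →
    ∀ (U : Set E³) (F : Cfg → ℝ), (∃ C : ℝ, ∀ ω, |F ω| ≤ C) →
      (∀ (ε : ℝ), 0 < ε →
        MeasureTheory.condExp (sig (Metric.thickening ε Uᶜ)) μ F =ᵐ[μ] MeasureTheory.condExp (sig (Metric.thickening ε (frontier U))) μ F) →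
      MeasureTheory.condExp ((⨅ (ε : ℝ) (_ : 0 < ε), sig (Metric.thickening ε Uᶜ)) ⊔ ⨅ (ε : ℝ) (_ : 0 < ε), sig (Metric.thickening ε (frontier U))) μ F
        =ᵐ[μ] MeasureTheory.condExp (⨅ (ε : ℝ) (_ : 0 < ε), sig (Metric.thickening ε (frontier U))) μ F

/-! ## §2 Registered stubs (the ONLY sorries of this file) -/

/-- Stub 1 — collar Markov property of the limit law for open balls (load-bearing, XL). -/
theorem stub_collarMarkovBall : Sig.stub_collarMarkovBall := by
  sorry

/-- Stub 2 — collar Markov property of the limit law for open half-spaces (load-bearing, XL; needs the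
global Markov property of the plus state on the lattice side). -/
theorem stub_collarMarkovHalfSpace : Sig.stub_collarMarkovHalfSpace := by
  sorry

/-- Stub 3 — germs from collars, pure measure theory on `𝒮'(ℝ³)` (M–L: Lévy's downward theorem). -/
theorem stub_germOfCollar : Sig.stub_germOfCollar := by
  sorry

/-! ## §3 Composition — the crux BY NAME from the three stubs (sorry-free) -/

/-- **COMPOSITION.** `Sig.stub_collarMarkovBall → Sig.stub_collarMarkovHalfSpace → Sig.stub_germOfCollar →
MarkovInheritance`: fix the data and hypotheses of the crux; `stub_germOfCollar` reduces the germ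
identity for `(μ, sig, U, F)` to the collar identity at every `ε > 0`, which is `stub_collarMarkovBall`
or `stub_collarMarkovHalfSpace` according to the shape of `U`. Pure logic; concludes
`Summit.CriticalPhenomena.Ising3DConformalLimit.Theses.MarkovRigidity.MarkovInheritance` by name. -/
theorem MarkovInheritance_of :
    Sig.stub_collarMarkovBall → Sig.stub_collarMarkovHalfSpace → Sig.stub_germOfCollar →
      Summit.CriticalPhenomena.Ising3DConformalLimit.Theses.MarkovRigidity.MarkovInheritance :=
  fun hBall hHalf hGerm ρ Δ S μ hρ hlim hzero hnd htr hsc hprob hmom hexp hdens sig hsig U hU F hF hbdd =>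
    hGerm μ hprob sig hsig U F hbdd fun ε hε =>
      hU.elim
        (fun hb => hBall ρ Δ S μ hρ hlim hzero hnd htr hsc hprob hmom hexp hdens sig hsig U hb F hF hbdd ε hε)
        (fun hh => hHalf ρ Δ S μ hρ hlim hzero hnd htr hsc hprob hmom hexp hdens sig hsig U hh F hF hbdd ε hε)

/-- The crux from the registered stubs (closed modulo exactly `stub_collarMarkovBall`,
`stub_collarMarkovHalfSpace`, `stub_germOfCollar`). -/
theorem MarkovInheritance_proof :
    Summit.CriticalPhenomena.Ising3DConformalLimit.Theses.MarkovRigidity.MarkovInheritance :=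
  MarkovInheritance_of stub_collarMarkovBall stub_collarMarkovHalfSpace stub_germOfCollar

end Summit.CriticalPhenomena.Ising3DConformalLimit.Cruxes.MarkovInheritance.Birth

end
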